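import Summits.AtomisticToContinuum.Crystallization.Theorems.OverbindingBudgetEnergyThinProfiles

/-!
# OverbindingBudget · decomp-a2c lens-4 g34 — part XXII-U: the finite TABLE shape of the affine certificates FIN-A-T / FIN-A-S; cone XXXVII

Helper file under `--supports stmt-AtomisticToContinuum-31280` (RDEF = `Theses.OverbindingBudget.RobustDefectLimitWindows`); closes nothing.

FIN-A-T `AffineCellEnergyT Λ₁ s₁ s₂ ω s₀ B e` / FIN-A-S `AffineSquareExtinct Λ₁ ω s₀ B e` (part O) quantify over every height band
`[η₁, η₂] ⊂ [3/8, 23/20]` of width `≤ ω` and every `h` in it.  This file reduces them to a TABLE indexed by the finitely many HEIGHT WINDOWS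
`H_k = [3/8 + kω, 3/8 + (k+2)ω]`, `3/8 + kω ≤ 23/20` (consecutive windows overlap by `ω`, so every band of width `≤ ω` lies in one window):
`AffineWindowBound a b n ω k s₀ B e` asks for ONE family of affine minorants `α_s + β_s·P ≤ layerField a b (P n + u)` valid on the window's spans
`P ∈ (s+1)·H_k`, slopes `|β_s| ≤ B`, and the level inequality `e + 22/(21 s₀³ (3/8 + kω)⁴) ≤ φ₀/2 + Σ_{s<s₀} (α_s + β_s (s+1) h)` at the TWO ENDPOINTS
`h` of `H_k` only (the right side is affine in `h`).  Seams: `affineBound_of_window`, ★ `affineCellEnergyT_of_table`, ★ `affineSquareExtinct_of_table`;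
cone XXXVII `rdef_thirtyseventh_of_recordK_table_ref` = cone XXXVI with FIN-A-T / FIN-A-S supplied by the tables TAB-T `AffineTableT` / TAB-S
`AffineTableS` [finite CERT·M: per (cell box × window) a rational tuple `(α_s, β_s)_{s<s₀}` — the shape census emits].
-/

noncomputable section

namespace Summit.AtomisticToContinuum.Crystallization.Theorems.OverbindingBudgetEnergyAffineTable

open Real Finset
open scoped RealInnerProductSpace
open Literature.MathematicalPhysics.StatisticalMechanics (lennardJones groundStateEnergy)
open Summit.AtomisticToContinuum.Crystallization.Theses.OverbindingBudget (RobustDefectLimitWindows)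
open Summit.AtomisticToContinuum.Crystallization.Theses.PricedLinkCensus (ChargedEnergyGap)
open Summit.AtomisticToContinuum.Crystallization.Theorems.ChargedEnergyGapNegative (eStar)
open Summit.AtomisticToContinuum.Crystallization.Theorems.OverbindingBudgetGradedBareness (CleanlessExcessT)
open Summit.AtomisticToContinuum.Crystallization.Theorems.OverbindingBudgetCoherentCut (CoherentResidual)
open Summit.AtomisticToContinuum.Crystallization.Theorems.OverbindingBudgetUniformCutStatements (GrossCleanBallsU)
open Summit.AtomisticToContinuum.Crystallization.Theorems.OverbindingBudgetElasticSplitScale (CompressedVirialLaw)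
open Summit.AtomisticToContinuum.Crystallization.Theorems.ChartedPlanarOrderChunkFloor (E3)
open Summit.AtomisticToContinuum.Crystallization.Theorems.OverbindingBudgetScaleWidening (DoorPeriodicW)
open Summit.AtomisticToContinuum.Crystallization.Theorems.OverbindingBudgetTwoShellShape (TwoShellShape BarlowGluingW)
open Summit.AtomisticToContinuum.Crystallization.Theorems.OverbindingBudgetStackedRigidityW (StackedReductionW GapStressVanishesW)
open Summit.AtomisticToContinuum.Crystallization.Theorems.OverbindingBudgetRegistryCut (IsUnitNormal Pinned RegistryResidual RegistryTube)
open Summit.AtomisticToContinuum.Crystallization.Theorems.OverbindingBudgetRegistryDichotomy (IsTType IsSType RegistryGeometryW BalancedLocus)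
open Summit.AtomisticToContinuum.Crystallization.Theorems.OverbindingBudgetRegistryDichotomyCW (RegistryMetricCW)
open Summit.AtomisticToContinuum.Crystallization.Theorems.OverbindingBudgetEnergyStraightening (layerField)
open Summit.AtomisticToContinuum.Crystallization.Theorems.OverbindingBudgetEnergyTubeBox (RegistryPinningP TubeConvexRefP)
open Summit.AtomisticToContinuum.Crystallization.Theorems.OverbindingBudgetEnergyAffineStraightening
  (AffineBound StackedHeightsOsc AffineCellEnergyT AffineSquareExtinct)
open Summit.AtomisticToContinuum.Crystallization.Theorems.OverbindingBudgetEnergyThinProfiles (rdef_thirtysixth_of_recordK_ref)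

/-! ## §1 The window table -/

/-- **one table row**: affine minorants on the height WINDOW `H_k = [3/8 + kω, 3/8 + (k+2)ω]` — slopes `|β_s| ≤ B`, validity on the spans
`P ∈ (s+1)·H_k`, and the level inequality at the two endpoints of `H_k` (tail allowance at the window's lower end). -/
def AffineWindowBound (a b n : E3) (ω : ℝ) (k s₀ : ℕ) (B e : ℝ) : Prop :=
  ∃ α β : ℕ → ℝ, (∀ s : ℕ, s < s₀ → |β s| ≤ B) ∧
    (∀ s : ℕ, s < s₀ → ∀ P : ℝ, ((s : ℝ) + 1) * (3 / 8 + k * ω) ≤ P → P ≤ ((s : ℝ) + 1) * (3 / 8 + (k + 2) * ω) →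
      ∀ u : E3, ⟪u, n⟫ = 0 → α s + β s * P ≤ layerField a b (P • n + u)) ∧
    e + 22 / (21 * (s₀ : ℝ) ^ 3 * (3 / 8 + k * ω) ^ 4) ≤
      layerField a b 0 / 2 + ∑ s ∈ range s₀, (α s + β s * (((s : ℝ) + 1) * (3 / 8 + k * ω))) ∧
    e + 22 / (21 * (s₀ : ℝ) ^ 3 * (3 / 8 + k * ω) ^ 4) ≤
      layerField a b 0 / 2 + ∑ s ∈ range s₀, (α s + β s * (((s : ℝ) + 1) * (3 / 8 + (k + 2) * ω)))

/-- **TAB-T · `AffineTableT Λ₁ s₁ s₂ ω s₀ B e`** [finite CERT·M]: a window row for every unpinned T-type cell and every window `H_k` meeting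
`[3/8, 23/20]`. [piece] -/
def AffineTableT (Λ₁ s₁ s₂ ω : ℝ) (s₀ : ℕ) (B e : ℝ) : Prop :=
  ∀ (a b n : E3), LinearIndependent ℝ ![a, b] → ‖a‖ ≤ Λ₁ → ‖b‖ ≤ Λ₁ →
    (∀ i j : ℤ, ((i : ℝ) • a + (j : ℝ) • b) ≠ 0 → 9 / 10 ≤ ‖(i : ℝ) • a + (j : ℝ) • b‖) → IsUnitNormal a b n → IsTType a b →
    ¬ Pinned s₁ s₂ a b → ∀ k : ℕ, 3 / 8 + (k : ℝ) * ω ≤ 23 / 20 → AffineWindowBound a b n ω k s₀ B e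

/-- **TAB-S · `AffineTableS Λ₁ ω s₀ B e`** [finite CERT·M]: a window row for every S-type cell and every window. [piece] -/
def AffineTableS (Λ₁ ω : ℝ) (s₀ : ℕ) (B e : ℝ) : Prop :=
  ∀ (a b n : E3), LinearIndependent ℝ ![a, b] → ‖a‖ ≤ Λ₁ → ‖b‖ ≤ Λ₁ →
    (∀ i j : ℤ, ((i : ℝ) • a + (j : ℝ) • b) ≠ 0 → 9 / 10 ≤ ‖(i : ℝ) • a + (j : ℝ) • b‖) → IsUnitNormal a b n → IsSType a b →
    ∀ k : ℕ, 3 / 8 + (k : ℝ) * ω ≤ 23 / 20 → AffineWindowBound a b n ω k s₀ B e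

/-! ## §2 A window row serves every band inside the window -/

/-- an affine function of `h` bounded below at both endpoints of an interval is bounded below on it. [this file] -/
theorem affine_ge_of_endpoints {L c D lo hi h : ℝ} (hlo : L ≤ c + D * lo) (hhi : L ≤ c + D * hi) (h1 : lo ≤ h) (h2 : h ≤ hi) :
    L ≤ c + D * h := by
  rcases le_or_gt 0 D with hD | hD
  · nlinarith [mul_le_mul_of_nonneg_left h1 hD]
  · nlinarith [mul_le_mul_of_nonpos_left h2 hD.le]

/-- **window ⟹ band**: a window row `H_k ⊇ [η₁, η₂]` gives `AffineBound a b n η₁ η₂ s₀ B h e` at every `h ∈ [η₁, η₂]`. [this file] -/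
theorem affineBound_of_window {a b n : E3} {ω η₁ η₂ h B e : ℝ} {k s₀ : ℕ} (hω : 0 ≤ ω)
    (hk : 3 / 8 + (k : ℝ) * ω ≤ η₁) (hk' : η₂ ≤ 3 / 8 + ((k : ℝ) + 2) * ω) (hh : h ∈ Set.Icc η₁ η₂)
    (hW : AffineWindowBound a b n ω k s₀ B e) : AffineBound a b n η₁ η₂ s₀ B h e := by
  obtain ⟨α, β, hB, hmin, hlo, hhi⟩ := hW
  have hlo0 : 0 < 3 / 8 + (k : ℝ) * ω := by positivity
  have hη₁ : 0 < η₁ := lt_of_lt_of_le hlo0 hk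
  refine ⟨α, β, hB, fun s hs P hP1 hP2 u hu => hmin s hs P ?_ ?_ u hu, ?_⟩
  · exact le_trans (mul_le_mul_of_nonneg_left hk (by positivity)) hP1
  · exact hP2.trans (mul_le_mul_of_nonneg_left hk' (by positivity))
  · -- tail allowance: `η₁ ≥ 3/8 + kω`
    have htail : 22 / (21 * (s₀ : ℝ) ^ 3 * η₁ ^ 4) ≤ 22 / (21 * (s₀ : ℝ) ^ 3 * (3 / 8 + (k : ℝ) * ω) ^ 4) := by
      rcases Nat.eq_zero_or_pos s₀ with hs0 | hs0
      · subst hs0; simp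
      · apply div_le_div_of_nonneg_left (by norm_num) (by positivity)
        exact mul_le_mul_of_nonneg_left (pow_le_pow_left₀ hlo0.le hk 4) (by positivity)
    -- the right side is affine in `h`: `c + D·h` with `D = Σ β_s (s+1)`
    have haff : ∀ x : ℝ, layerField a b 0 / 2 + ∑ s ∈ range s₀, (α s + β s * (((s : ℝ) + 1) * x)) =
        (layerField a b 0 / 2 + ∑ s ∈ range s₀, α s) + (∑ s ∈ range s₀, β s * ((s : ℝ) + 1)) * x := by
      intro x
      rw [sum_add_distrib, sum_mul]
      have : ∑ s ∈ range s₀, β s * (((s : ℝ) + 1) * x) = ∑ s ∈ range s₀, β s * ((s : ℝ) + 1) * x :=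
        sum_congr rfl fun s _ => by ring
      rw [this]; ring
    rw [haff] at hlo hhi ⊢
    have := affine_ge_of_endpoints hlo hhi (hk.trans hh.1) (hh.2.trans hk')
    linarith

/-- the window index of a band: `k = ⌊(η₁ − 3/8)/ω⌋₊`. [this file] -/
theorem exists_window {ω η₁ η₂ : ℝ} (hω : 0 < ω) (h1 : 3 / 8 ≤ η₁) (h12 : η₁ ≤ η₂) (h2 : η₂ ≤ 23 / 20) (hband : η₂ - η₁ ≤ ω) :
    ∃ k : ℕ, 3 / 8 + (k : ℝ) * ω ≤ η₁ ∧ η₂ ≤ 3 / 8 + ((k : ℝ) + 2) * ω ∧ 3 / 8 + (k : ℝ) * ω ≤ 23 / 20 := by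
  refine ⟨⌊(η₁ - 3 / 8) / ω⌋₊, ?_, ?_, ?_⟩
  · have := Nat.floor_le (div_nonneg (by linarith) hω.le : 0 ≤ (η₁ - 3 / 8) / ω)
    rw [le_div_iff₀ hω] at this
    linarith
  · have := Nat.lt_floor_add_one ((η₁ - 3 / 8) / ω)
    rw [div_lt_iff₀ hω] at this
    nlinarith
  · have := Nat.floor_le (div_nonneg (by linarith) hω.le : 0 ≤ (η₁ - 3 / 8) / ω)
    rw [le_div_iff₀ hω] at this
    linarith

/-- ★ **TAB-T ⟹ FIN-A-T.** [this file] -/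
theorem affineCellEnergyT_of_table {Λ₁ s₁ s₂ ω B e : ℝ} {s₀ : ℕ} (hω : 0 < ω) (hT : AffineTableT Λ₁ s₁ s₂ ω s₀ B e) :
    AffineCellEnergyT Λ₁ s₁ s₂ ω s₀ B e := by
  intro a b n hab ha hb hmin hn hTT hnp η₁ η₂ h1 h2 hband h hh
  obtain ⟨k, hk, hk', hk23⟩ := exists_window hω h1 (hh.1.trans hh.2) h2 hband
  exact affineBound_of_window hω.le hk hk' hh (hT a b n hab ha hb hmin hn hTT hnp k hk23)

/-- ★ **TAB-S ⟹ FIN-A-S.** [this file] -/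
theorem affineSquareExtinct_of_table {Λ₁ ω B e : ℝ} {s₀ : ℕ} (hω : 0 < ω) (hT : AffineTableS Λ₁ ω s₀ B e) :
    AffineSquareExtinct Λ₁ ω s₀ B e := by
  intro a b n hab ha hb hmin hn hSS η₁ η₂ h1 h2 hband h hh
  obtain ⟨k, hk, hk', hk23⟩ := exists_window hω h1 (hh.1.trans hh.2) h2 hband
  exact affineBound_of_window hω.le hk hk' hh (hT a b n hab ha hb hmin hn hSS k hk23)

/-! ## §3 Cone XXXVII: cone XXXVI with the affine certificates in TABLE shape -/

/-- **Cone XXXVII** (= cone XXXVI `…EnergyThinProfiles.rdef_thirtysixth_of_recordK_ref` with FIN-A-T / FIN-A-S supplied by the finite window tables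
TAB-T `AffineTableT` / TAB-S `AffineTableS`, `ω > 0`): beneath ★ `StackedCellPinningU` the energy-side leaves are GEO-OSC `StackedHeightsOsc (17/16) ω`
[CERT·S] and the two tables [finite CERT·M]. [this file] -/
theorem rdef_thirtyseventh_of_recordK_table_ref (s₁ s₂ h₀ κ' ω B : ℝ) (s₀ : ℕ) (hκ' : 0 < κ') (hω : 0 < ω) (hs₀ : 4 ≤ s₀)
    (hG : GrossCleanBallsU (1 / 250) 10)
    (hCEG : ChargedEnergyGap) (hC : CompressedVirialLaw (1 / 250) 10) (hS : TwoShellShape (1 / 100) (3 / 50) (1 / 450)) (hB₂ : BarlowGluingW)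
    (hD : DoorPeriodicW 2) (hSR : StackedReductionW 2 (17 / 16)) (hV : GapStressVanishesW (17 / 16))
    (hP : RegistryPinningP (17 / 16) (1 / 40) (3 / 16) s₁ s₂ 1 0) (hT : TubeConvexRefP (17 / 16) (1 / 40) s₁ s₂ 1 0)
    (hOSC : StackedHeightsOsc (17 / 16) ω)
    (hTT : AffineTableT (17 / 16) s₁ s₂ ω s₀ B (eStar + 2 * κ')) (hTS : AffineTableS (17 / 16) ω s₀ B (eStar + 2 * κ'))
    (hGeo : RegistryGeometryW (17 / 16) s₁ s₂ h₀ (3 / 20))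
    (hBal : BalancedLocus s₁ s₂ h₀ (1 / 40)) (hR1 : RegistryResidual s₁ s₂ (1 / 250)) (hR2 : RegistryTube s₁ s₂ (1 / 100) 1)
    (hMet : RegistryMetricCW s₁ s₂ (3 / 500)) (hCE : CleanlessExcessT) (hRes : CoherentResidual 10) : RobustDefectLimitWindows :=
  rdef_thirtysixth_of_recordK_ref s₁ s₂ h₀ κ' ω B s₀ hκ' hs₀ hG hCEG hC hS hB₂ hD hSR hV hP hT hOSC
    (affineCellEnergyT_of_table hω hTT) (affineSquareExtinct_of_table hω hTS) hGeo hBal hR1 hR2 hMet hCE hRes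

end Summit.AtomisticToContinuum.Crystallization.Theorems.OverbindingBudgetEnergyAffineTable

end
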